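import Mathlib
import HarnessLib
import Summits.MatrixMultiplication.Statement
import Summits.MatrixMultiplication.MatrixMultiplication.Theses.LongExchangeCondensation
import Summits.MatrixMultiplication.MatrixMultiplication.Theorems.LongExchangeCondensationLongExchangeSound

/-!
# Route `LongExchangeCondensation` — the assembly item (stmt-MatrixMultiplication-20138)

`Assembly : LongExchangeSound → ShortLongCondensation → MatrixMultiplication` is, verbatim, the route's deciding theorem
`closes` (Theses file, sorry-free: Baur–Strassen bridge `DerivationsBoundOmega_of (2+ε)` for every `ε > 0`, then
`le_of_forall_pos_le_add` and `omega_two_le`).  With the rung `LongExchangeSound` proved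
(`Theorems/LongExchangeCondensationLongExchangeSound.lean`), the route now reads: `ShortLongCondensation → ω(ℂ) = 2`
(`MatrixMultiplication_of_ShortLongCondensation` below) — the carrier (crux 3, open problem) is all that remains.
Sources: BurgisserClausenShokrollahi1997 (Thm. (7.7) Baur–Strassen, §16), BaurStrassen1983.
-/

set_option linter.dupNamespace false

namespace Summit.MatrixMultiplication.MatrixMultiplication.Theorems.LongExchangeCondensationAssembly

open Summit.MatrixMultiplication.MatrixMultiplication.Theses.LongExchangeCondensation
  (LongExchangeSound ShortLongCondensation closes)

/-- **The assembly item** `Summit.MatrixMultiplication.MatrixMultiplication.Theses.LongExchangeCondensation.Assembly`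
(stmt-MatrixMultiplication-20138): it is the route's deciding theorem `closes`. [cite: BurgisserClausenShokrollahi1997, Thm. (7.7)] -/
theorem Assembly_of : Summit.MatrixMultiplication.MatrixMultiplication.Theses.LongExchangeCondensation.Assembly :=
  fun hR hX => closes hR hX

/-- **What the route now says.**  With the rung proved (`LongExchangeSound_of`), the carrier alone implies the summit:
quadratic-weighted valid long-exchange derivations of `det X_n` for all large `n` give `ω(ℂ) = 2`.
[cite: BurgisserClausenShokrollahi1997, Thm. (7.7)] -/
theorem MatrixMultiplication_of_ShortLongCondensation : ShortLongCondensation → _root_.MatrixMultiplication :=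
  fun hX => closes LongExchangeSound.LongExchangeSound_of hX

end Summit.MatrixMultiplication.MatrixMultiplication.Theorems.LongExchangeCondensationAssembly
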